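import Literature.Computability.Complexity.DiagRoutines
import Literature.Computability.Complexity.FlatFuel
import Literature.Computability.Complexity.NTIMEVerifierNormal
import Literature.Computability.Complexity.NTIMEHierarchyDiagonal
import Literature.Computability.Complexity.TM2ToStackProgram
import HarnessLib

/-!
# The diagonalizing machine, II: assembly, and the nondeterministic time hierarchy theorem

Literature / complexity toolkit. This file assembles the machine `D` of
`NTIMEHierarchyDiagonal.lean` (`Diagonalizer f`) from the routines of `DiagRoutines.lean`, the
fuel device of `FlatFuel.lean`, the flat normal form of `TM2` machines (`TM2ToStackProgram.lean`),
the uniform multi-pass check (`FlatTranscripts.lean`, `TranscriptChecker.lean`) and the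
normalised verifier (`NTIMEVerifierNormal.lean`), and proves
**`diagonalizer_of_timeConstructible_holds`**, whence the nondeterministic time hierarchy
theorem **`ntime_hierarchy_holds`** (`ntime_hierarchy_of_diagonalizer`).

The flat program `Dprog` of `D` on input `⟨x, w⟩` (register `inreg`):
1. `preTop` — un-pair the input; split `x = H ++ 0 1^j` (the fuel `1^j` goes to the clock
   register); read the header `H = ⟨b, pad⟩`, `b = 1^m 0 1^inp 0 1^out 0 1^E 0 1^q 0 code`
   (normalising: every word reads as some header); compute AHEAD the answer of a simulated
   position — `simCore` on `(x ++ [1], w)` — and save it on a register the segment never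
   mentions; prepare the first chain word `H ++ [0]` and `1^{|H|+1}` for the clock program.
2. the ticked segment (`FlatFuel.tick`) of `SEG = (clock program of f, renamed) ++ (search)`:
   with fuel `j` it either is interrupted (`j < J`, exit `X`) or completes (`j ≥ J`) where `J`
   is the halting time of the segment — a function of `H` alone;
3. `postTop` — interrupted: answer the saved simulated answer; completed with the fuel exactly
   used up (`j = J`): answer the NEGATION of the search result; fuel left over: answer `0`;
   then clear every register but the answer.

All three phases are linear in `|⟨x, w⟩|` (phase 2 costs at most `2j + 1`), uniformly, which
is the one-constant `NTIME f` bound the `Diagonalizer` interface demands; the three clauses of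
`Diagonalizer.diag` are read off the three answers.

## References

* S. A. Cook, *A hierarchy for nondeterministic time complexity*, JCSS 7 (1973), Thm. 2.
* J. I. Seiferas, M. J. Fischer, A. R. Meyer, *Separating nondeterministic time complexity
  classes*, JACM 25 (1978), Thm. 3.
* S. Žák, *A Turing machine time hierarchy*, TCS 26 (1983), 327–333.
* S. Arora, B. Barak, *Computational Complexity: A Modern Approach*, CUP 2009, Thm. 3.2, §1.4.1.
-/

namespace Literature.Computability.Complexity

open Function ACom StackWhile

namespace Diag

/-! ### Generic flat-program facts: renaming, untouched registers, size, clearing -/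

section Flat

variable {κ ι : Type} [DecidableEq κ] [DecidableEq ι]

/-- The renamed copy of an instruction, jump targets saturated at `len`. [folklore] -/
def renameI (g : κ → ι) (len : ℕ) : AInstr Bool κ → AInstr Bool ι
  | .push k b => .push (g k) b
  | .pop k j => .pop (g k) fun o => min (j o) len
  | .goto j => .goto (min j len)

/-- **The renamed copy of a flat program** (same addresses; halting jumps land at `|P|`).
[folklore] -/
def renameProg (g : κ → ι) (P : AProg Bool κ) : AProg Bool ι := P.map (renameI g P.length)

omit [DecidableEq κ] [DecidableEq ι] in
/-- Length of the renamed program. [folklore] -/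
@[simp] theorem length_renameProg (g : κ → ι) (P : AProg Bool κ) : (renameProg g P).length = P.length := by
  simp [renameProg]

/-- **One step of the renamed copy** placed at `0` in `Q`, on grafted stores.
[folklore] -/
theorem step_rename {g : κ → ι} (hg : Injective g) (P : AProg Bool κ) (Q : AProg Bool ι)
    (hQ : Placed Q 0 (renameProg g P)) (S : AStore Bool ι) {pc : ℕ} (hpc : pc < P.length) (R : AStore Bool κ) :
    Q.step ⟨pc, graft S g R⟩ = ⟨min (P.step ⟨pc, R⟩).pc P.length, graft S g (P.step ⟨pc, R⟩).regs⟩ := by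
  obtain ⟨ins, hins⟩ : ∃ ins, P[pc]? = some ins := ⟨P[pc], List.getElem?_eq_getElem hpc⟩
  have hq : Q[pc]? = some (renameI g P.length ins) := by
    have := hQ pc (by simpa using hpc)
    rw [Nat.zero_add] at this
    rw [this]
    unfold renameProg
    rw [List.getElem_map]
    have e : P[pc] = ins := Option.some.inj ((List.getElem?_eq_getElem hpc).symm.trans hins)
    rw [e]
  rw [Q.step_of_getElem? hq, P.step_of_getElem? hins]
  cases ins with
  | push k b => simp [renameI, graft_apply S hg, graft_update_eq S hg]; omega
  | goto j => simp [renameI]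
  | pop k j =>
    simp only [renameI, graft_apply S hg]
    cases R k with
    | nil => rfl
    | cons a w => simp [graft_update_eq S hg]

/-- **Unhalted steps of the renamed copy.** [folklore] -/
theorem iterate_rename {g : κ → ι} (hg : Injective g) (P : AProg Bool κ) (Q : AProg Bool ι)
    (hQ : Placed Q 0 (renameProg g P)) (S : AStore Bool ι) : ∀ (n : ℕ) (c : ACfg Bool κ),
    (∀ m < n, (P.step^[m] c).pc < P.length) →
    Q.step^[n] ⟨min c.pc P.length, graft S g c.regs⟩ = ⟨min (P.step^[n] c).pc P.length, graft S g (P.step^[n] c).regs⟩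
  | 0, c, h => by simp
  | n + 1, c, h => by
    have h0 : c.pc < P.length := by simpa using h 0 (Nat.succ_pos n)
    have e1 := step_rename hg P Q hQ S h0 c.regs
    have ih := iterate_rename hg P Q hQ S n (P.step c) (fun m hm => by
      have := h (m + 1) (by omega)
      rwa [Function.iterate_succ_apply] at this)
    rw [Function.iterate_succ_apply, Nat.min_eq_left h0.le, show (⟨c.pc, c.regs⟩ : ACfg Bool κ) = c from rfl] at *
    rw [e1, ih, Function.iterate_succ_apply]

/-- **The renamed copy of a halting run**: if `P` reaches the halted address `|P|` at time `t`
from `c`, then `Q` reaches `|P|` at the first halting time `J ≤ t`, with the grafted final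
store, having been inside the copy before. [folklore] -/
theorem rename_complete {g : κ → ι} (hg : Injective g) (P : AProg Bool κ) (Q : AProg Bool ι)
    (hQ : Placed Q 0 (renameProg g P)) (S : AStore Bool ι) (c : ACfg Bool κ) (hc : c.pc < P.length) (t : ℕ)
    (R' : AStore Bool κ) (ht : P.step^[t] c = ⟨P.length, R'⟩) :
    ∃ J ≤ t, (∀ m < J, (Q.step^[m] ⟨c.pc, graft S g c.regs⟩).pc < P.length) ∧
      Q.step^[J] ⟨c.pc, graft S g c.regs⟩ = ⟨P.length, graft S g R'⟩ := by
  obtain ⟨J, hJt, hin, hhalt, hcfg⟩ := FlatFuel.exists_haltTime P c t (by rw [ht])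
  refine ⟨J, hJt, fun m hm => ?_, ?_⟩
  · have e := iterate_rename hg P Q hQ S m c (fun m' hm' => hin m' (by omega))
    rw [Nat.min_eq_left hc.le] at e
    rw [e]
    simp only
    rw [Nat.min_eq_left (hin m hm).le]; exact hin m hm
  · have e := iterate_rename hg P Q hQ S J c hin
    rw [Nat.min_eq_left hc.le] at e
    rw [e, hcfg, ht]
    simp

/-! #### Registers an instruction, a program, a structured program does not mention -/

/-- The register an instruction works on, if any. [folklore] -/
def _root_.Literature.Computability.Complexity.AInstr.reg : AInstr Bool ι → Option ι
  | .push k _ => some k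
  | .pop k _ => some k
  | .goto _ => none

/-- **A register no instruction works on is never changed.** [folklore] -/
theorem step_regs_of_forall_ne (Q : AProg Bool ι) (k : ι) (hk : ∀ ins ∈ Q, ins.reg ≠ some k) (c : ACfg Bool ι) :
    (Q.step c).regs k = c.regs k := by
  unfold AProg.step
  cases hq : Q[c.pc]? with
  | none => rfl
  | some ins =>
    have hmem : ins ∈ Q := List.mem_of_getElem? hq
    have hne := hk ins hmem
    cases ins with
    | push k' b => simp only; rw [update_of_ne]; exact fun h => hne (by subst h; rfl)
    | goto j => rfl
    | pop k' j =>
      simp only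
      cases c.regs k' with
      | nil => rfl
      | cons a w => simp only; rw [update_of_ne]; exact fun h => hne (by subst h; rfl)

/-- Hence along any run. [folklore] -/
theorem iterate_regs_of_forall_ne (Q : AProg Bool ι) (k : ι) (hk : ∀ ins ∈ Q, ins.reg ≠ some k) (n : ℕ) (c : ACfg Bool ι) :
    (Q.step^[n] c).regs k = c.regs k := by
  induction n with
  | zero => rfl
  | succ n ih => rw [Function.iterate_succ_apply', step_regs_of_forall_ne Q k hk, ih]

/-- Whether a structured program mentions a register. [folklore] -/
def Mentions (k : ι) : ACom Bool ι → Prop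
  | .push k' _ => k' = k
  | .pop k' f => k' = k ∨ ∃ o, Mentions k (f o)
  | .seq c₁ c₂ => Mentions k c₁ ∨ Mentions k c₂
  | .skip => False
  | .loop k' f => k' = k ∨ ∃ a, Mentions k (f a)

omit [DecidableEq κ] [DecidableEq ι] in
/-- A renamed program mentions only renamed registers. [folklore] -/
theorem mentions_map_iff {f : κ → ι} (k : ι) : ∀ (c : ACom Bool κ), Mentions k (c.map f) ↔ ∃ k', f k' = k ∧ Mentions k' c
  | .push k' b => by simp [ACom.map, Mentions]
  | .pop k' g => by
    simp only [ACom.map, Mentions, mentions_map_iff k (g _)]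
    constructor
    · rintro (rfl | ⟨o, k'', rfl, h⟩)
      · exact ⟨k', rfl, Or.inl rfl⟩
      · exact ⟨k'', rfl, Or.inr ⟨o, h⟩⟩
    · rintro ⟨k'', rfl, rfl | ⟨o, h⟩⟩
      · exact Or.inl rfl
      · exact Or.inr ⟨o, k'', rfl, h⟩
  | .seq c₁ c₂ => by
    simp only [ACom.map, Mentions, mentions_map_iff k c₁, mentions_map_iff k c₂]
    constructor
    · rintro (⟨k', rfl, h⟩ | ⟨k', rfl, h⟩)
      · exact ⟨k', rfl, Or.inl h⟩
      · exact ⟨k', rfl, Or.inr h⟩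
    · rintro ⟨k', rfl, h | h⟩
      · exact Or.inl ⟨k', rfl, h⟩
      · exact Or.inr ⟨k', rfl, h⟩
  | .skip => by simp [ACom.map, Mentions]
  | .loop k' g => by
    simp only [ACom.map, Mentions, mentions_map_iff k (g _)]
    constructor
    · rintro (rfl | ⟨o, k'', rfl, h⟩)
      · exact ⟨k', rfl, Or.inl rfl⟩
      · exact ⟨k'', rfl, Or.inr ⟨o, h⟩⟩
    · rintro ⟨k'', rfl, rfl | ⟨o, h⟩⟩
      · exact Or.inl rfl
      · exact Or.inr ⟨o, k'', rfl, h⟩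

omit [DecidableEq ι] in
/-- Membership in a block layout: in one of the blocks, or one of the jumps. [folklore] -/
theorem mem_blocks {X : Type} {g : X → ℕ → AProg Bool ι} {sz : X → ℕ} {j : ℕ} {ins : AInstr Bool ι} :
    ∀ {xs : List X} {addr : ℕ}, ins ∈ blocks g sz j xs addr → (∃ x a, ins ∈ g x a) ∨ ins = AInstr.goto j
  | [], _, h => by simp [blocks] at h
  | x :: xs, addr, h => by
    simp only [blocks, List.mem_append, List.mem_cons] at h
    rcases h with h | rfl | h
    · exact Or.inl ⟨x, addr, h⟩
    · exact Or.inr rfl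
    · exact mem_blocks h

omit [DecidableEq ι] in
/-- **The code of a structured program works only on registers it mentions.** [folklore] -/
theorem reg_of_mem_code (k : ι) : ∀ (c : ACom Bool ι) (base : ℕ) (ins : AInstr Bool ι),
    ins ∈ code c base → ins.reg = some k → Mentions k c
  | .push k' b, base, ins, h, hr => by
    simp only [code, List.mem_singleton] at h; subst h
    simp only [AInstr.reg, Option.some.injEq] at hr; exact hr
  | .pop k' g, base, ins, h, hr => by
    rw [code, List.mem_cons] at h
    rcases h with rfl | h
    · simp only [AInstr.reg, Option.some.injEq] at hr; exact Or.inl hr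
    · rcases mem_blocks h with ⟨o, addr, h⟩ | rfl
      · exact Or.inr ⟨o, reg_of_mem_code k (g o) addr ins h hr⟩
      · simp [AInstr.reg] at hr
  | .seq c₁ c₂, base, ins, h, hr => by
    rw [code, List.mem_append] at h
    rcases h with h | h
    · exact Or.inl (reg_of_mem_code k c₁ _ ins h hr)
    · exact Or.inr (reg_of_mem_code k c₂ _ ins h hr)
  | .skip, base, ins, h, hr => by simp [code] at h
  | .loop k' g, base, ins, h, hr => by
    rw [code, List.mem_cons] at h
    rcases h with rfl | h
    · simp only [AInstr.reg, Option.some.injEq] at hr; exact Or.inl hr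
    · rcases mem_blocks h with ⟨o, addr, h⟩ | rfl
      · exact Or.inr ⟨o, reg_of_mem_code k (g o) addr ins h hr⟩
      · simp [AInstr.reg] at hr

/-! #### Size along flat runs; clearing registers -/

/-- **One flat step grows the store by at most one symbol.** [folklore] -/
theorem ssize_step_le [Fintype ι] (Q : AProg Bool ι) (c : ACfg Bool ι) : ssize (Q.step c).regs ≤ ssize c.regs + 1 := by
  unfold AProg.step
  cases hq : Q[c.pc]? with
  | none => simp
  | some ins =>
    cases ins with
    | push k b => have := ssize_update c.regs k (b :: c.regs k); simp at this ⊢; omega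
    | goto j => simp
    | pop k j =>
      simp only
      cases hk : c.regs k with
      | nil => simp
      | cons a w => have := ssize_update c.regs k w; rw [hk] at this; simp at this ⊢; omega

/-- Hence along a run. [folklore] -/
theorem ssize_iterate_le [Fintype ι] (Q : AProg Bool ι) (n : ℕ) (c : ACfg Bool ι) : ssize (Q.step^[n] c).regs ≤ ssize c.regs + n := by
  induction n with
  | zero => simp
  | succ n ih => rw [Function.iterate_succ_apply']; have := ssize_step_le Q (Q.step^[n] c); omega

/-- `clearAll l`: clear the registers of `l` in turn. [folklore] -/
def clearAll : List ι → ACom Bool ι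
  | [] => skip
  | k :: l => clear k ;; clearAll l

/-- **Effect and cost of `clearAll`.** [folklore] -/
theorem runs_clearAll : ∀ (l : List ι) (R : AStore Bool ι),
    Runs (clearAll l) R (fun r => if r ∈ l then [] else R r) (2 * (l.map fun k => (R k).length).sum + l.length)
  | [], R => by simpa [clearAll] using Runs.skip R
  | k :: l, R => by
    have h1 := runs_clear (Γ := Bool) k R
    have h2 := runs_clearAll l (update R k [])
    refine ((h1.seq h2).of_eq ?_ ?_)
    · funext r
      by_cases hr : r = k
      · subst hr; simp
      · simp [hr]
    · have : (l.map fun k' => (update R k [] k').length).sum ≤ (l.map fun k' => (R k').length).sum := by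
        refine List.sum_le_sum ?_
        intro k' _
        by_cases h : k' = k
        · subst h; simp
        · rw [update_of_ne h]
      simp only [List.map_cons, List.sum_cons, List.length_cons]
      omega

omit [DecidableEq ι] in
/-- The registers cleared from a finite register file are within its size. [folklore] -/
theorem sum_toList_le_ssize [Fintype ι] (s : Finset ι) (R : AStore Bool ι) :
    (s.toList.map fun k => (R k).length).sum ≤ ssize R := by
  rw [Finset.sum_map_toList]
  exact Finset.sum_le_sum_of_subset (Finset.subset_univ s)

end Flat

/-! ### The phase before the segment, on structured stores -/

variable {Kf : ℕ}

/-- **`readBlock` from `xr` onto `ones`** (the fuel staging register). [folklore] -/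
theorem runs_readBlock_xr (s : DSt Kf) (l acc : List Bool) :
    Runs (readBlock .xr .ones .w) { s with xr := l, w := [], ones := acc }.store
      { s with xr := (rdNum l).2, w := [], ones := un (rdNum l).1 ++ acc }.store (6 * (rdNum l).1 + 6) := by
  obtain ⟨a, t, ht, rfl⟩ := exists_un_append_isTail l
  have hrd : rdNum (un a ++ t) = (a, t.tail) := by rw [rdNum, lead_un_append ht]
  obtain ⟨R', h, g1, g2, g3, g4⟩ := runs_readBlock (src := DReg.xr) (dst := DReg.ones) (w := DReg.w) (by simp) (by simp)
    (by simp) (a := a) (t := t) ht ({ s with xr := un a ++ t, w := [], ones := acc } : DSt Kf).store (by simp) (by simp)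
  rw [hrd]
  refine h.of_eq ?_ le_rfl
  funext r
  by_cases h1 : r = DReg.ones
  · subst h1; rw [g2]; simp
  · by_cases h2 : r = DReg.xr
    · subst h2; rw [g1]; simp
    · by_cases h3 : r = DReg.w
      · subst h3; rw [g3]; simp
      · rw [g4 r h2 h1 h3]
        have e1 := congrFun (DSt.update_store_xr ({ s with w := [], ones := acc } : DSt Kf) (un a ++ t)) r
        have e2 := congrFun (DSt.update_store_xr ({ s with w := [], ones := acc } : DSt Kf) t.tail) r
        have e3 := congrFun (DSt.update_store_ones ({ s with xr := t.tail, w := [] } : DSt Kf) (un a ++ acc)) r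
        have e4 := congrFun (DSt.update_store_ones ({ s with xr := t.tail, w := [] } : DSt Kf) acc) r
        rw [update_of_ne h2] at e1 e2
        rw [update_of_ne h1] at e3 e4
        simp only at e1 e2 e3 e4
        rw [← e1, e2, ← e4, e3]

/-- The fuel and the (reversed) header part of the input word `x = H ++ 0 1^j`: read as a block
off `x⁻¹`. [folklore] -/
def jOf (x : List Bool) : ℕ := (rdNum x.reverse).1

/-- The header part `H` of the input word. [folklore] -/
def HOf (x : List Bool) : List Bool := (rdNum x.reverse).2.reverse

/-- On a chain word `(base ++ pad) ++ 0 :: 1^j` the split is the expected one. [folklore] -/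
theorem jOf_chainInput (B : List Bool) (j : ℕ) : jOf (chainInput B j) = j ∧ HOf (chainInput B j) = B := by
  have h : (chainInput B j).reverse = UChk.blk j ++ B.reverse := by
    simp [chainInput, UChk.blk, un, List.reverse_append]
  simp only [jOf, HOf, h, rdNum_blk, List.reverse_reverse, and_self]

/-- **`preD inpf`**: everything before the segment, on the structured registers: un-pair the
input, split off the fuel (staged on `ones`), read the header, compute the simulated answer
ahead (`sv`), prepare the first chain word and the clock program's input. [folklore] -/
def preD (inpf : Fin Kf) : Prog Kf :=
  inPhase ;; pour .xc .xr ;; readBlock .xr .ones .w ;; hPhase inpf ;; bPhase ;; hdrFields ;; svPhase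

/-- The header fields of an input word. [folklore] -/
def hdrX (x : List Bool) : HdrV := hdrOf (bOf (HOf x))

/-- The yardstick of the checker for an input word. [folklore] -/
def KX (x : List Bool) : ℕ := (hdrX x).out + (hdrX x).inp + (hdrX x).m

/-- **The start store of the segment** for input `⟨x, w⟩` (the simulated answer `sv` given).
[folklore] -/
def segStart (inpf : Fin Kf) (x : List Bool) (sv : List Bool) : DSt Kf :=
  { (scSt ({} : DSt Kf) (hdrX x).P (KX x) (hdrX x).m (hdrX x).inp (hdrX x).out (HOf x ++ [false]) []) with
      xx := x, ones := un (jOf x), sv := sv, ee := un (hdrX x).E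
      pf := update (fun _ => []) inpf (un ((HOf x).length + 1)) }

/-- The empty structured store is the empty store. [folklore] -/
theorem store_default : (({} : DSt Kf).store) = fun _ => [] := by
  funext r
  cases r
  case u r' => cases r' <;> rfl
  all_goals rfl

/-- The size of the input store. [folklore] -/
theorem ssize_inreg (v : List Bool) : ssize ({ inreg := v } : DSt Kf).store = v.length := by
  have e : ({ inreg := v } : DSt Kf).store = update ({} : DSt Kf).store .inreg v := (DSt.update_store_inreg {} v).symm
  have h := ssize_update ({} : DSt Kf).store DReg.inreg v
  rw [← e, store_default] at h
  have h0 : ssize (fun _ : DReg Kf => ([] : List Bool)) = 0 := by simp [ssize]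
  simp only [List.length_nil, add_zero] at h
  omega

/-- **Effect, cost and saved answer of `preD`.** [folklore] -/
theorem runs_preD (inpf : Fin Kf) (x w : List Bool) : ∃ sv : List Bool,
    Runs (preD inpf) ({ inreg := boolPair x w } : DSt Kf).store (segStart inpf x sv).store
      (scConst * (210 * (x.length + w.length) + 130) + 300 * (x.length + w.length) + 200) ∧
    (sv = [] ∨ sv = [true]) ∧
    (sv = [true] ↔ SimOK (hdrX x).P (KX x) (hdrX x).m (hdrX x).inp (hdrX x).out (x ++ [true]) w) := by
  -- names
  set j := jOf x with hj
  set H := HOf x with hH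
  set b := bOf H with hb
  have hjx : j + H.length ≤ x.length := by
    have := rdNum_le x.reverse
    simp only [hj, hH, jOf, HOf, List.length_reverse] at this ⊢; exact this
  have hbH : b.length ≤ H.length := by
    rw [hb, bOf]
    rcases hu : DiagPrelims.unpair H with _ | ⟨b', pad⟩
    · simp
    · have := DiagPrelims.length_of_unpair hu; simp; omega
  have hfld := hdrOf_le b
  have hhx : hdrX x = hdrOf b := by rw [hdrX, ← hH, ← hb]
  set m := (hdrOf b).m with hm
  set inp := (hdrOf b).inp with hinp'
  set out := (hdrOf b).out with hout'
  set E := (hdrOf b).E with hE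
  set P := (hdrOf b).P with hP
  have hK : KX x = out + inp + m := by rw [KX, hhx]
  -- the phases
  have e1 : Runs inPhase ({ inreg := boolPair x w } : DSt Kf).store ({ inreg := w, xx := x, xc := x } : DSt Kf).store
      (24 * x.length + 12 * w.length + 25) :=
    (runs_inPhase ({} : DSt Kf) x w).of_eq (by simp) le_rfl |>.init (by simp)
  have e2 : Runs (pour .xc .xr) ({ inreg := w, xx := x, xc := x } : DSt Kf).store ({ inreg := w, xx := x, xr := x.reverse } : DSt Kf).store
      (3 * x.length + 1) := (runs_pour (Γ := Bool) (a := DReg.xc) (b := DReg.xr) (by simp) _).of_eq (by simp) (by simp)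
  have e3 : Runs (readBlock .xr .ones .w) ({ inreg := w, xx := x, xr := x.reverse } : DSt Kf).store
      ({ inreg := w, xx := x, xr := H.reverse, ones := un j } : DSt Kf).store (6 * j + 6) :=
    (runs_readBlock_xr ({ inreg := w, xx := x } : DSt Kf) x.reverse []).of_eq (by simp [hH, HOf, hj, jOf]) (by rw [hj, jOf])
      |>.init (by simp)
  have e4 : Runs (hPhase inpf) ({ inreg := w, xx := x, xr := H.reverse, ones := un j } : DSt Kf).store
      ({ inreg := w, xx := x, ones := un j, hh := H, h2 := H, zz := H ++ [false], pf := update (fun _ => []) inpf (un (H.length + 1)) } :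
        DSt Kf).store (1 + (6 * H.length + 1) + 1) :=
    (runs_hPhase ({ inreg := w, xx := x, ones := un j } : DSt Kf) inpf H rfl).of_eq (by simp) le_rfl |>.init (by simp)
  have e5 : Runs bPhase ({ inreg := w, xx := x, ones := un j, hh := H, h2 := H, zz := H ++ [false], pf := update (fun _ => []) inpf (un (H.length + 1)) } :
        DSt Kf).store
      ({ inreg := w, xx := x, ones := un j, h2 := H, zz := H ++ [false], pf := update (fun _ => []) inpf (un (H.length + 1)), bb := b } :
        DSt Kf).store (19 * H.length + 16) :=
    (runs_bPhase ({ inreg := w, xx := x, ones := un j, h2 := H, zz := H ++ [false], pf := update (fun _ => []) inpf (un (H.length + 1)) } :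
      DSt Kf) H).of_eq (by simp [hb]) le_rfl |>.init (by simp)
  -- the base store of the last two phases
  let s' : DSt Kf := { inreg := w, xx := x, ones := un j, h2 := H, zz := H ++ [false], pf := update (fun _ => []) inpf (un (H.length + 1)) }
  have e6 : Runs hdrFields ({ s' with bb := b } : DSt Kf).store (hdrSt s' b).store (130 * b.length + 60) :=
    (runs_hdrFields s' b).init (by simp [s'])
  let s'' : DSt Kf := { ones := un j, pf := update (fun _ => []) inpf (un (H.length + 1)), ee := un E }
  have hsv : hdrSt s' b = svSt s'' P (out + inp + m) m inp out x w (H ++ [false]) [] H := by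
    simp [hdrSt, svSt, scSt, s', s'', UChk.U0, hm, hinp', hout', hE, hP]
  obtain ⟨sv, e7, hsv1, hsv2⟩ := runs_svPhase s'' P (out + inp + m) m inp out (by omega) (by omega) x w H (H ++ [false])
  rw [← hsv] at e7
  have hend : svSt s'' P (out + inp + m) m inp out x [] (H ++ [false]) sv [] = segStart inpf x sv := by
    simp [svSt, scSt, s'', segStart, hhx, hK, ← hH, ← hj, hm, hinp', hout', hE, hP]
  rw [hend] at e7
  -- sizes
  have hsz : ssize (hdrSt s' b).store ≤ (2 * x.length + 2 + w.length) + ((24 * x.length + 12 * w.length + 25) + ((3 * x.length + 1) +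
      ((6 * j + 6) + ((1 + (6 * H.length + 1) + 1) + ((19 * H.length + 16) + (130 * b.length + 60)))))) := by
    obtain ⟨t, ht, ex⟩ := e1.seq (e2.seq (e3.seq (e4.seq (e5.seq e6))))
    have h := ex.ssize_le
    rw [ssize_inreg, length_boolPair] at h
    omega
  refine ⟨sv, ?_, hsv1, by rw [hhx, hK]; exact hsv2⟩
  unfold preD
  have e7' := e7.mono (le_refl _)
  simp only [List.length_append, List.length_singleton] at e7'
  refine Runs.mono (e1.seq (e2.seq (e3.seq (e4.seq (e5.seq (e6.seq e7')))))) ?_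
  have hsc : scConst * (ssize (hdrSt s' b).store + 13 * x.length + 6 * w.length + 2 * (H.length + 1) + 8) ≤
      scConst * (210 * (x.length + w.length) + 130) := Nat.mul_le_mul_left _ (by omega)
  omega

/-! ### The segment: the clock program, renamed, followed by the search -/

/-- **The segment** run under fuel: the flat clock program on the registers `pf`, then the code
of the exhaustive search. [folklore] -/
noncomputable def SEG (Pf : AProg Bool (Fin Kf)) (outf : Fin Kf) : AProg Bool (DReg Kf) :=
  renameProg DReg.pf Pf ++ code (search outf) Pf.length

/-- The registers the segment may work on: the clock program's and those the search mentions.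
[folklore] -/
def SegReg (outf : Fin Kf) (k : DReg Kf) : Prop := (∃ i, k = .pf i) ∨ Mentions k (search outf)

/-- Every instruction of the segment works on a segment register. [folklore] -/
theorem segReg_of_mem (Pf : AProg Bool (Fin Kf)) (outf : Fin Kf) {ins : AInstr Bool (DReg Kf)} (h : ins ∈ SEG Pf outf)
    {k : DReg Kf} (hk : ins.reg = some k) : SegReg outf k := by
  unfold SEG at h
  rw [List.mem_append] at h
  rcases h with h | h
  · left
    unfold renameProg at h
    obtain ⟨i, _, rfl⟩ := List.mem_map.1 h
    cases i with
    | push k' b => exact ⟨k', by simpa [renameI, AInstr.reg] using hk.symm⟩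
    | pop k' j => exact ⟨k', by simpa [renameI, AInstr.reg] using hk.symm⟩
    | goto j => simp [renameI, AInstr.reg] at hk
  · exact Or.inr (reg_of_mem_code k _ _ ins h hk)

/-- The registers the segment leaves alone: the saved answer, the answer, the dispatch mark, the
input copy, the fuel staging register. [folklore] -/
theorem not_segReg (outf : Fin Kf) :
    ¬ SegReg outf .sv ∧ ¬ SegReg outf .ans ∧ ¬ SegReg outf .mark ∧ ¬ SegReg outf .xx ∧ ¬ SegReg outf .ones := by
  simp [SegReg, Mentions, search, srchInit, srchLoop, srchBody, simCore, badBr, failB, okB, flagBr, iniLoop, unpairTr,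
    fstBr, pairBr, bsuccP, bsBr, grewBr, nnBr, vdBr, mulP, copy2, pour, clear, mentions_map_iff, Option.exists]

/-! #### Runs that agree on the registers a program works on -/

section Agree

variable {ι : Type} [DecidableEq ι]

/-- **Stores agreeing on the working registers give parallel runs**: same addresses, agreeing
stores. [folklore] -/
theorem step_agree (Q : AProg Bool ι) (M : ι → Prop) (hM : ∀ ins ∈ Q, ∀ k, ins.reg = some k → M k)
    {pc : ℕ} {R R' : AStore Bool ι} (h : ∀ k, M k → R k = R' k) :
    (Q.step ⟨pc, R⟩).pc = (Q.step ⟨pc, R'⟩).pc ∧ ∀ k, M k → (Q.step ⟨pc, R⟩).regs k = (Q.step ⟨pc, R'⟩).regs k := by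
  unfold AProg.step
  cases hq : Q[pc]? with
  | none => exact ⟨rfl, h⟩
  | some ins =>
    have hmem : ins ∈ Q := List.mem_of_getElem? hq
    cases ins with
    | push k' b =>
      have hk' : M k' := hM _ hmem k' rfl
      refine ⟨rfl, fun k hk => ?_⟩
      simp only
      by_cases e : k = k'
      · subst e; simp [h k hk]
      · rw [update_of_ne e, update_of_ne e]; exact h k hk
    | goto j => exact ⟨rfl, h⟩
    | pop k' j =>
      have hk' : M k' := hM _ hmem k' rfl
      simp only
      rw [← h k' hk']
      cases R k' with
      | nil => exact ⟨rfl, h⟩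
      | cons a w =>
        refine ⟨rfl, fun k hk => ?_⟩
        simp only
        by_cases e : k = k'
        · subst e; simp
        · rw [update_of_ne e, update_of_ne e]; exact h k hk

/-- Hence along runs. [folklore] -/
theorem iterate_agree (Q : AProg Bool ι) (M : ι → Prop) (hM : ∀ ins ∈ Q, ∀ k, ins.reg = some k → M k) :
    ∀ (n : ℕ) {pc : ℕ} {R R' : AStore Bool ι}, (∀ k, M k → R k = R' k) →
    (Q.step^[n] ⟨pc, R⟩).pc = (Q.step^[n] ⟨pc, R'⟩).pc ∧ ∀ k, M k → (Q.step^[n] ⟨pc, R⟩).regs k = (Q.step^[n] ⟨pc, R'⟩).regs k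
  | 0, pc, R, R', h => ⟨rfl, h⟩
  | n + 1, pc, R, R', h => by
    obtain ⟨hpc, hregs⟩ := iterate_agree Q M hM n h
    rw [Function.iterate_succ_apply', Function.iterate_succ_apply']
    have e1 : Q.step^[n] ⟨pc, R⟩ = ⟨(Q.step^[n] ⟨pc, R⟩).pc, (Q.step^[n] ⟨pc, R⟩).regs⟩ := rfl
    have e2 : Q.step^[n] ⟨pc, R'⟩ = ⟨(Q.step^[n] ⟨pc, R⟩).pc, (Q.step^[n] ⟨pc, R'⟩).regs⟩ := by rw [hpc]
    rw [e1, e2]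
    exact step_agree Q M hM hregs

end Agree

/-! ### The run of the segment -/

/-- **The canonical start store of the segment** for header part `H`: it depends on `H` only.
[folklore] -/
def segCanon (inpf : Fin Kf) (H : List Bool) : DSt Kf :=
  { (scSt ({} : DSt Kf) (hdrOf (bOf H)).P ((hdrOf (bOf H)).out + (hdrOf (bOf H)).inp + (hdrOf (bOf H)).m) (hdrOf (bOf H)).m
      (hdrOf (bOf H)).inp (hdrOf (bOf H)).out (H ++ [false]) []) with
      ee := un (hdrOf (bOf H)).E, pf := update (fun _ => []) inpf (un (H.length + 1)) }

/-- The actual start store of the segment (the staged fuel moved to the clock): the canonical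
one plus two registers the segment ignores. [folklore] -/
def segAct (inpf : Fin Kf) (x : List Bool) (sv : List Bool) : DSt Kf := { (segCanon inpf (HOf x)) with xx := x, sv := sv }

/-- The store after `preD` is the actual start plus the staged fuel. [folklore] -/
theorem segStart_eq (inpf : Fin Kf) (x : List Bool) (sv : List Bool) :
    segStart inpf x sv = { (segAct inpf x sv) with ones := un (jOf x) } := by
  simp [segStart, segAct, segCanon, hdrX, KX, scSt]

section Seg

variable (f : ℕ → ℕ) (Pf : AProg Bool (Fin Kf)) (inpf outf : Fin Kf)
variable (hPf : ∀ n : ℕ, ∃ t : ℕ, Pf.step^[t] ⟨0, AStore.single inpf (un n)⟩ = ⟨Pf.length, AStore.single outf (boolPair (un n) (un (f n)))⟩)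

include hPf in
/-- The clock program is not empty. [folklore] -/
theorem pf_pos : 0 < Pf.length := by
  by_contra h0
  have hl : Pf.length = 0 := by omega
  obtain ⟨t, ht⟩ := hPf 1
  rw [Pf.iterate_step_of_le (by rw [hl])] at ht
  have e := congrArg (fun c : ACfg Bool (Fin Kf) => (c.regs inpf).length) ht
  simp only [AStore.single, if_true] at e
  split_ifs at e with h
  · simp [un] at e; omega
  · simp [un] at e

include hPf in
/-- **The run of the segment from its canonical start**: the clock program computes
`⟨1^{|H|+1}, 1^{f(|H|+1)}⟩`, then the search runs; the segment halts at a first time `J`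
(inside the program before), with `res = [1]` iff some word of length `≤ E · f(|H|+1)` passes
`simCore` on the first chain word `H ++ [0]`. [folklore] -/
theorem seg_run (H : List Bool) : ∃ (J : ℕ) (fin : DSt Kf),
    (∀ m < J, ((SEG Pf outf).step^[m] ⟨0, (segCanon inpf H).store⟩).pc < (SEG Pf outf).length) ∧
    (SEG Pf outf).step^[J] ⟨0, (segCanon inpf H).store⟩ = ⟨(SEG Pf outf).length, fin.store⟩ ∧
    (fin.res = [true] ↔ ∃ v, v.length ≤ (hdrOf (bOf H)).E * f (H.length + 1) ∧
      SimOK (hdrOf (bOf H)).P ((hdrOf (bOf H)).out + (hdrOf (bOf H)).inp + (hdrOf (bOf H)).m) (hdrOf (bOf H)).m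
        (hdrOf (bOf H)).inp (hdrOf (bOf H)).out (H ++ [false]) v) ∧ (fin.res = [] ∨ fin.res = [true]) := by
  set hd := hdrOf (bOf H) with hhd
  set K := hd.out + hd.inp + hd.m with hK
  set n := H.length + 1 with hn
  have hplaced : Placed (SEG Pf outf) 0 (renameProg DReg.pf Pf ++ code (search outf) Pf.length) := placed_self (SEG Pf outf)
  have hpl1 : Placed (SEG Pf outf) 0 (renameProg DReg.pf Pf) := hplaced.left
  have hpl2 : Placed (SEG Pf outf) Pf.length (code (search outf) Pf.length) := by simpa using hplaced.right
  -- phase A: the clock program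
  obtain ⟨t, ht⟩ := hPf n
  have hinj : Injective (DReg.pf : Fin Kf → DReg Kf) := fun a b h => by simpa using h
  obtain ⟨J₁, -, hin₁, hJ₁⟩ := rename_complete hinj Pf (SEG Pf outf) hpl1 (segCanon inpf H).store ⟨0, AStore.single inpf (un n)⟩
    (pf_pos f Pf inpf outf hPf) t _ ht
  have hg0 : graft (segCanon inpf H).store DReg.pf (AStore.single inpf (un n)) = (segCanon inpf H).store := by
    rw [DSt.graft_pf]; congr 1
    simp only [segCanon, hn]
    congr 1; funext i; simp [AStore.single, update_apply]
  simp only [hg0] at hin₁ hJ₁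
  -- phase B: the search
  obtain ⟨B, cur', r', hrun, hiff, h01⟩ := runs_search ({} : DSt Kf) hd.P K hd.m hd.inp hd.out (by omega) (by omega) (H ++ [false]) hd.E n (f n) outf
  obtain ⟨n₂, -, ex⟩ := hrun
  have hA : graft (segCanon inpf H).store DReg.pf (AStore.single outf (boolPair (un n) (un (f n)))) =
      (srch0 ({} : DSt Kf) hd.P K hd.m hd.inp hd.out (H ++ [false]) hd.E n (f n) outf).store := by
    rw [DSt.graft_pf]; congr 1
    simp only [segCanon, srch0, srchSt, srchBase, scSt, hhd, hK, un]
    congr 1; funext i; simp [AStore.single, update_apply]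
  have hB := ex.iterate_step (Q := SEG Pf outf) (base := Pf.length) hpl2
  rw [← hA, ← hJ₁, ← Function.iterate_add_apply] at hB
  have hlen : (SEG Pf outf).length = Pf.length + (search outf).size := by simp [SEG]
  -- the first halting time
  obtain ⟨J, hJle, hin, hhalt, hcfg⟩ := FlatFuel.exists_haltTime (SEG Pf outf) ⟨0, (segCanon inpf H).store⟩ (n₂ + J₁) (by rw [hB, hlen])
  refine ⟨J, srchSt (srchBase ({} : DSt Kf) hd.E) hd.P K hd.m hd.inp hd.out (H ++ [false]) cur' 0 r' [], hin, ?_, ?_, ?_⟩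
  · rw [hcfg, hB, hlen]
  · show r' = [true] ↔ _
    exact hiff
  · show r' = [] ∨ r' = [true]
    exact h01

/-- The segment registers include `res`. [folklore] -/
theorem segReg_res : SegReg outf .res := by
  right; simp [Mentions, search, srchLoop, srchBody, vdBr, clear, Option.exists]

include hPf in
/-- **The run of the segment from the actual start** of input `⟨x, w⟩`: the same halting
structure as from the canonical start of `H = HOf x`, the same `res`, the saved answer `sv`
untouched. [folklore] -/
theorem seg_run_actual (x : List Bool) (sv : List Bool) : ∃ (J : ℕ) (fin : DSt Kf) (Rfin : AStore Bool (DReg Kf)),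
    (∀ m < J, ((SEG Pf outf).step^[m] ⟨0, (segAct inpf x sv).store⟩).pc < (SEG Pf outf).length) ∧
    (SEG Pf outf).step^[J] ⟨0, (segAct inpf x sv).store⟩ = ⟨(SEG Pf outf).length, Rfin⟩ ∧
    Rfin .res = fin.res ∧
    (∀ m, ((SEG Pf outf).step^[m] ⟨0, (segAct inpf x sv).store⟩).regs .sv = sv ∧
      ((SEG Pf outf).step^[m] ⟨0, (segAct inpf x sv).store⟩).regs .mark = [] ∧
      ((SEG Pf outf).step^[m] ⟨0, (segAct inpf x sv).store⟩).regs .ans = []) ∧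
    (SEG Pf outf).step^[J] ⟨0, (segCanon inpf (HOf x)).store⟩ = ⟨(SEG Pf outf).length, fin.store⟩ ∧
    (∀ m < J, ((SEG Pf outf).step^[m] ⟨0, (segCanon inpf (HOf x)).store⟩).pc < (SEG Pf outf).length) ∧
    (fin.res = [true] ↔ ∃ v, v.length ≤ (hdrX x).E * f ((HOf x).length + 1) ∧
      SimOK (hdrX x).P (KX x) (hdrX x).m (hdrX x).inp (hdrX x).out (HOf x ++ [false]) v) ∧ (fin.res = [] ∨ fin.res = [true]) := by
  obtain ⟨J, fin, hin, hJ, hiff, h01⟩ := seg_run f Pf inpf outf hPf (HOf x)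
  have hM : ∀ ins ∈ SEG Pf outf, ∀ k, ins.reg = some k → SegReg outf k := fun ins h k hk => segReg_of_mem Pf outf h hk
  obtain ⟨nsv, nans, nmark, nxx, nones⟩ := not_segReg (Kf := Kf) outf
  have hagree : ∀ k, SegReg outf k → (segCanon inpf (HOf x)).store k = (segAct inpf x sv).store k := by
    intro k hk
    have e := congrFun (DSt.update_store_xx (({ (segCanon inpf (HOf x)) with sv := sv } : DSt Kf)) x) k
    have e3 := congrFun (DSt.update_store_sv (segCanon inpf (HOf x)) sv) k
    rw [update_of_ne (fun h : k = DReg.xx => nxx (h ▸ hk))] at e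
    rw [update_of_ne (fun h : k = DReg.sv => nsv (h ▸ hk))] at e3
    simp only at e e3
    rw [segAct, ← e, ← e3]
  have hpar := fun m => iterate_agree (SEG Pf outf) (SegReg outf) hM m (pc := 0) hagree
  refine ⟨J, fin, ((SEG Pf outf).step^[J] ⟨0, (segAct inpf x sv).store⟩).regs, fun m hm => ?_, ?_, ?_, fun m => ⟨?_, ?_, ?_⟩, hJ, hin, ?_, h01⟩
  · rw [← (hpar m).1]; exact hin m hm
  · have h1 := (hpar J).1
    rw [hJ] at h1
    have : ∀ c : ACfg Bool (DReg Kf), c = ⟨c.pc, c.regs⟩ := fun c => rfl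
    rw [this ((SEG Pf outf).step^[J] ⟨0, (segAct inpf x sv).store⟩), ← h1]
  · have h2 := (hpar J).2 .res (segReg_res outf)
    rw [hJ] at h2
    exact h2.symm
  · rw [iterate_regs_of_forall_ne (SEG Pf outf) .sv (fun ins h e => nsv (hM ins h _ e))]
    simp [segAct, segCanon, scSt]
  · rw [iterate_regs_of_forall_ne (SEG Pf outf) .mark (fun ins h e => nmark (hM ins h _ e))]
    simp [segAct, segCanon, scSt]
  · rw [iterate_regs_of_forall_ne (SEG Pf outf) .ans (fun ins h e => nans (hM ins h _ e))]
    simp [segAct, segCanon, scSt]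
  · simpa [hdrX, KX] using hiff

end Seg

/-! ### The top level: fuel register and the three phases -/

/-- The registers of `D`: the structured ones, and the clock (`none`). [folklore] -/
abbrev TR (Kf : ℕ) : Type := Option (DReg Kf)

section Top

variable (f : ℕ → ℕ) (Pf : AProg Bool (Fin Kf)) (inpf outf : Fin Kf)
variable (hPf : ∀ n : ℕ, ∃ t : ℕ, Pf.step^[t] ⟨0, AStore.single inpf (un n)⟩ = ⟨Pf.length, AStore.single outf (boolPair (un n) (un (f n)))⟩)

/-- **Phase 1**: `preD` on the structured registers, then the staged fuel onto the clock.
[folklore] -/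
noncomputable def preTop : ACom Bool (TR Kf) := (preD inpf).map some ;; pour (some .ones) none

/-- Answer from the saved simulated answer. [folklore] -/
def svBr : Option Bool → ACom Bool (TR Kf)
  | some _ => push (some .ans) true
  | none => push (some .ans) false

/-- Answer at the exact position: the negation of the search result. [folklore] -/
def resBr : Option Bool → ACom Bool (TR Kf)
  | none => push (some .ans) true
  | some _ => push (some .ans) false

/-- Completed: exact fuel or fuel left over. [folklore] -/
def fuelBr : Option Bool → ACom Bool (TR Kf)
  | none => pop (some .res) resBr
  | some _ => push (some .ans) false

/-- Dispatch: the mark is set iff the segment completed. [folklore] -/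
def markBr : Option Bool → ACom Bool (TR Kf)
  | some _ => pop none fuelBr
  | none => pop (some .sv) svBr

/-- All registers but the answer. [folklore] -/
noncomputable def REST : List (TR Kf) := (Finset.univ.erase (some DReg.ans)).toList

/-- **Phase 3 without its first instruction** (entered here when the fuel ran out). [folklore] -/
noncomputable def postTail : ACom Bool (TR Kf) := pop (some .mark) markBr ;; clearAll REST

/-- **Phase 3** (entered here when the segment completed). [folklore] -/
noncomputable def postTop : ACom Bool (TR Kf) := push (some .mark) true ;; postTail

/-- The address of the ticked segment. [folklore] -/
noncomputable def Bad : ℕ := (preTop inpf : ACom Bool (TR Kf)).size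

/-- The address of phase 3. [folklore] -/
noncomputable def Cad : ℕ := Bad inpf + 2 * (SEG Pf outf).length

/-- **The flat program of the diagonalizer.** [folklore] -/
noncomputable def Dprog : AProg Bool (TR Kf) :=
  code (preTop inpf) 0 ++ FlatFuel.tick some none (Bad inpf) (Cad Pf inpf outf + 1) (SEG Pf outf) ++ code postTop (Cad Pf inpf outf)

/-- Length of the program. [folklore] -/
theorem length_Dprog : (Dprog Pf inpf outf).length = Cad Pf inpf outf + 1 + (postTail : ACom Bool (TR Kf)).size := by
  simp [Dprog, Cad, Bad, postTop, size]; omega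

/-- Placement of phase 1. [folklore] -/
theorem placed_pre : Placed (Dprog Pf inpf outf) 0 (code (preTop inpf) 0) :=
  ((placed_self (Dprog Pf inpf outf)).left).left

/-- Placement of the ticked segment. [folklore] -/
theorem placed_tick : Placed (Dprog Pf inpf outf) (Bad inpf) (FlatFuel.tick some none (Bad inpf) (Cad Pf inpf outf + 1) (SEG Pf outf)) := by
  simpa [Bad] using ((placed_self (Dprog Pf inpf outf)).left).right

/-- Placement of phase 3. [folklore] -/
theorem placed_post : Placed (Dprog Pf inpf outf) (Cad Pf inpf outf) (code postTop (Cad Pf inpf outf)) := by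
  simpa [Cad, Bad] using (placed_self (Dprog Pf inpf outf)).right

/-- Placement of the tail of phase 3. [folklore] -/
theorem placed_postTail : Placed (Dprog Pf inpf outf) (Cad Pf inpf outf + 1) (code postTail (Cad Pf inpf outf + 1)) := by
  have h := placed_post Pf inpf outf
  rw [postTop, code] at h
  simpa [code, size] using h.right

/-- The input store. [folklore] -/
theorem single_inreg (v : List Bool) (i : DReg Kf) :
    AStore.single (some DReg.inreg : TR Kf) v (some i) = ({ inreg := v } : DSt Kf).store i := by
  have e : ({ inreg := v } : DSt Kf).store = update ({} : DSt Kf).store .inreg v := (DSt.update_store_inreg {} v).symm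
  rw [e, store_default]
  simp [AStore.single, update_apply]

/-- The size of a one-register store. [folklore] -/
theorem ssize_single {ι : Type} [DecidableEq ι] [Fintype ι] (k : ι) (v : List Bool) : ssize (AStore.single k v) = v.length := by
  have e : AStore.single k v = update (fun _ => []) k v := by funext r; simp [AStore.single, update_apply]
  have h := ssize_update (fun _ : ι => ([] : List Bool)) k v
  have h0 : ssize (fun _ : ι => ([] : List Bool)) = 0 := by simp [ssize]
  rw [← e] at h; simp only [List.length_nil, add_zero] at h; omega

/-- **Phase 3, completed case.** From a store with empty `mark` and `ans`: the answer bit is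
`[fuel = [] ∧ res = []]`, then everything but `ans` is cleared. [folklore] -/
theorem runs_postTop (R : AStore Bool (TR Kf)) (hmark : R (some .mark) = []) (hans : R (some .ans) = [])
    (hres : R (some .res) = [] ∨ R (some .res) = [true]) :
    Runs postTop R (AStore.single (some DReg.ans) [decide (R none = [] ∧ R (some .res) = [])])
      (2 * ssize R + (REST : List (TR Kf)).length + 12) := by
  -- the answer
  have ANS : ∃ (R₁ : AStore Bool (TR Kf)) (B₁ : ℕ), Runs (pop none fuelBr) (update (update R (some .mark) [true]) (some .mark) []) R₁ B₁ ∧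
      B₁ ≤ 7 ∧ R₁ (some .ans) = [decide (R none = [] ∧ R (some .res) = [])] ∧ ssize R₁ ≤ ssize R + 1 := by
    rw [update_idem, update_eq_self_iff.2 hmark.symm]
    · rcases hn : R none with _ | ⟨b, fu⟩
      · rcases hres with hr | hr
        · refine ⟨update R (some .ans) [true], _, Runs.pop_nil hn (Runs.pop_nil hr (Runs.push' (by rw [hans]))), by omega, by simp [hr], ?_⟩
          have := ssize_update R (some DReg.ans) [true]; rw [hans] at this; simp at this; omega
        · refine ⟨update (update R (some .res) []) (some .ans) [false], _,
            Runs.pop_nil hn (Runs.pop_cons' (f := resBr) (a := true) (w := []) hr rfl (Runs.push' (by simp [hans]))), by omega,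
            by simp [hr], ?_⟩
          have h1 := ssize_update R (some DReg.res) []; rw [hr] at h1
          have h2 := ssize_update (update R (some DReg.res) []) (some DReg.ans) [false]
          rw [update_of_ne (by simp), hans] at h2; simp at h1 h2; omega
      · refine ⟨update (update R none fu) (some .ans) [false], _,
          Runs.pop_cons' (f := fuelBr) (a := b) (w := fu) hn rfl (Runs.push' (by simp [hans])), by omega, by simp, ?_⟩
        have h1 := ssize_update R none fu; rw [hn] at h1
        have h2 := ssize_update (update R none fu) (some DReg.ans) [false]
        rw [update_of_ne (by simp), hans] at h2; simp at h1 h2; omega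
  obtain ⟨R₁, B₁, hA, hB₁, hans₁, hsz₁⟩ := ANS
  have e1 : Runs (push (some DReg.mark) true) R (update R (some .mark) [true]) 1 := Runs.push' (by rw [hmark])
  have e2 : Runs (pop (some .mark) markBr) (update R (some .mark) [true]) R₁ (B₁ + 2) :=
    Runs.pop_cons' (f := markBr) (a := true) (w := []) (by simp) rfl hA
  have e3 := runs_clearAll (REST : List (TR Kf)) R₁
  have hsum : ((REST : List (TR Kf)).map fun k => (R₁ k).length).sum ≤ ssize R₁ := sum_toList_le_ssize _ R₁
  unfold postTop postTail
  refine Runs.of_eq (e1.seq (e2.seq e3)) ?_ ?_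
  · funext r
    by_cases hr : r = some DReg.ans
    · subst hr; simp [REST, AStore.single, hans₁]
    · have : r ∈ (REST : List (TR Kf)) := by simp [REST, hr]
      simp [this, AStore.single, hr]
  · omega

/-- **Phase 3, interrupted case** (entered at its tail). The answer bit is `[sv = [1]]`.
[folklore] -/
theorem runs_postTail (R : AStore Bool (TR Kf)) (hmark : R (some .mark) = []) (hans : R (some .ans) = [])
    (hsv : R (some .sv) = [] ∨ R (some .sv) = [true]) :
    Runs postTail R (AStore.single (some DReg.ans) [decide (R (some .sv) = [true])])
      (2 * ssize R + (REST : List (TR Kf)).length + 8) := by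
  have ANS : ∃ (R₁ : AStore Bool (TR Kf)) (B₁ : ℕ), Runs (pop (some .sv) svBr) R R₁ B₁ ∧
      B₁ ≤ 3 ∧ R₁ (some .ans) = [decide (R (some .sv) = [true])] ∧ ssize R₁ ≤ ssize R + 1 := by
    rcases hsv with h | h
    · refine ⟨update R (some .ans) [false], _, Runs.pop_nil h (Runs.push' (by rw [hans])), by omega, by simp [h], ?_⟩
      have := ssize_update R (some DReg.ans) [false]; rw [hans] at this; simp at this; omega
    · refine ⟨update (update R (some .sv) []) (some .ans) [true], _,
        Runs.pop_cons' (f := svBr) (a := true) (w := []) h rfl (Runs.push' (by simp [hans])), by omega, by simp [h], ?_⟩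
      have h1 := ssize_update R (some DReg.sv) []; rw [h] at h1
      have h2 := ssize_update (update R (some DReg.sv) []) (some DReg.ans) [true]
      rw [update_of_ne (by simp), hans] at h2; simp at h1 h2; omega
  obtain ⟨R₁, B₁, hA, hB₁, hans₁, hsz₁⟩ := ANS
  have e2 : Runs (pop (some .mark) markBr) R R₁ (B₁ + 2) := Runs.pop_nil hmark hA
  have e3 := runs_clearAll (REST : List (TR Kf)) R₁
  have hsum : ((REST : List (TR Kf)).map fun k => (R₁ k).length).sum ≤ ssize R₁ := sum_toList_le_ssize _ R₁
  unfold postTail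
  refine Runs.of_eq (e2.seq e3) ?_ ?_
  · funext r
    by_cases hr : r = some DReg.ans
    · subst hr; simp [REST, AStore.single, hans₁]
    · have : r ∈ (REST : List (TR Kf)) := by simp [REST, hr]
      simp [this, AStore.single, hr]
  · omega

end Top

/-! ### The run of the diagonalizer -/

section Run

variable (f : ℕ → ℕ) (Pf : AProg Bool (Fin Kf)) (inpf outf : Fin Kf)
variable (hPf : ∀ n : ℕ, ∃ t : ℕ, Pf.step^[t] ⟨0, AStore.single inpf (un n)⟩ = ⟨Pf.length, AStore.single outf (boolPair (un n) (un (f n)))⟩)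

/-- **The halting time of the segment** for header part `H` (a function of `H` alone).
[folklore] -/
noncomputable def segJ (H : List Bool) : ℕ := Classical.choose (seg_run f Pf inpf outf hPf H)

/-- The final store of the segment for header part `H`. [folklore] -/
noncomputable def segFin (H : List Bool) : DSt Kf := Classical.choose (Classical.choose_spec (seg_run f Pf inpf outf hPf H))

/-- The specification of `segJ` / `segFin`. [folklore] -/
theorem segJ_spec (H : List Bool) :
    (∀ m < segJ f Pf inpf outf hPf H, ((SEG Pf outf).step^[m] ⟨0, (segCanon inpf H).store⟩).pc < (SEG Pf outf).length) ∧
    (SEG Pf outf).step^[segJ f Pf inpf outf hPf H] ⟨0, (segCanon inpf H).store⟩ = ⟨(SEG Pf outf).length, (segFin f Pf inpf outf hPf H).store⟩ ∧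
    ((segFin f Pf inpf outf hPf H).res = [true] ↔ ∃ v, v.length ≤ (hdrOf (bOf H)).E * f (H.length + 1) ∧
      SimOK (hdrOf (bOf H)).P ((hdrOf (bOf H)).out + (hdrOf (bOf H)).inp + (hdrOf (bOf H)).m) (hdrOf (bOf H)).m
        (hdrOf (bOf H)).inp (hdrOf (bOf H)).out (H ++ [false]) v) ∧
    ((segFin f Pf inpf outf hPf H).res = [] ∨ (segFin f Pf inpf outf hPf H).res = [true]) :=
  Classical.choose_spec (Classical.choose_spec (seg_run f Pf inpf outf hPf H))

/-- **What the diagonalizer answers** on `⟨x, w⟩`: with `x = H ++ 0 1^j` and `J` the halting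
time of the segment for `H` — `j < J`: the simulated answer; `j = J`: the negation of the search
result; `j > J`: no. [folklore] -/
def DSpec (x w : List Bool) : Prop :=
  (jOf x < segJ f Pf inpf outf hPf (HOf x) ∧ SimOK (hdrX x).P (KX x) (hdrX x).m (hdrX x).inp (hdrX x).out (x ++ [true]) w) ∨
  (jOf x = segJ f Pf inpf outf hPf (HOf x) ∧ (segFin f Pf inpf outf hPf (HOf x)).res = [])

/-- The time constant of the diagonalizer. [folklore] -/
noncomputable def Dconst (Kf : ℕ) : ℕ := 3000000 + (REST : List (TR Kf)).length

include hPf in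
/-- **The run of the diagonalizer**: on input `⟨x, w⟩` the flat program halts with the single
answer symbol `[DSpec x w]` on `ans`, everything else empty, within `Dconst · (|x| + |w|) + Dconst`
steps. [folklore] -/
theorem D_run (x w : List Bool) : ∃ (b : Bool) (t : ℕ),
    (Dprog Pf inpf outf).step^[t] ⟨0, AStore.single (some DReg.inreg) (boolPair x w)⟩ =
      ⟨(Dprog Pf inpf outf).length, AStore.single (some DReg.ans) [b]⟩ ∧
    t ≤ Dconst Kf * (x.length + w.length) + Dconst Kf ∧ (b = true ↔ DSpec f Pf inpf outf hPf x w) := by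
  classical
  set D := Dprog Pf inpf outf with hD
  set j := jOf x with hj
  set H := HOf x with hH
  have hjx : j ≤ x.length := by
    have := rdNum_le x.reverse; simp only [List.length_reverse] at this; rw [hj, jOf]; omega
  -- phase 1
  obtain ⟨sv, hpre, hsv01, hsviff⟩ := runs_preD inpf x w
  set T0 : AStore Bool (TR Kf) := AStore.single (some DReg.inreg) (boolPair x w) with hT0
  have hS : ∀ i, T0 (some i) = ({ inreg := boolPair x w } : DSt Kf).store i := single_inreg (boolPair x w)
  have h1 := hpre.map (f := (some : DReg Kf → TR Kf)) (Option.some_injective _) T0 hS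
  set G₁ := graft T0 some (segStart inpf x sv).store with hG₁
  have hG₁n : G₁ none = [] := by rw [hG₁, graft_of_not _ _ _ (fun i => by simp)]; simp [hT0, AStore.single]
  have hG₁s : ∀ r, G₁ (some r) = (segStart inpf x sv).store r := fun r => graft_apply _ (Option.some_injective _) _ r
  have h2 := runs_pour (Γ := Bool) (a := (some DReg.ones : TR Kf)) (b := none) (by simp) G₁
  have hones : G₁ (some .ones) = un j := by rw [hG₁s]; simp [segStart, scSt, hj]
  rw [hones, hG₁n] at h2
  simp only [un, List.reverse_replicate, List.append_nil, List.length_replicate] at h2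
  set c₀ : ACfg Bool (DReg Kf) := ⟨0, (segAct inpf x sv).store⟩ with hc₀
  set T₁ := FlatFuel.tstore G₁ some none c₀.regs (un j) with hT₁
  have hT₁eq : update (update G₁ (some DReg.ones) []) none (List.replicate j true) = T₁ := by
    funext o
    rcases o with _ | r
    · simp [hT₁, FlatFuel.tstore, un]
    · have hn : (some r : TR Kf) ≠ none := by simp
      rw [update_of_ne hn, hT₁, FlatFuel.tstore, update_of_ne hn, graft_apply _ (Option.some_injective _)]
      by_cases hr : r = DReg.ones
      · subst hr; simp [hc₀, segAct, segCanon, scSt]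
      · rw [update_of_ne (by simpa using hr), hG₁s, segStart_eq]
        have := congrFun (DSt.update_store_ones (segAct inpf x sv) (un (jOf x))) r
        rw [update_of_ne hr] at this
        exact this.symm
  rw [hT₁eq] at h2
  obtain ⟨t₁, ht₁, ex₁⟩ := h1.seq h2
  have hD₁ : D.step^[t₁] ⟨0, T0⟩ = ⟨Bad inpf, T₁⟩ := by
    have := ex₁.iterate_step (placed_pre Pf inpf outf); rwa [Nat.zero_add] at this
  have hDc : Dconst Kf = 3000000 + (REST : List (TR Kf)).length := rfl
  have h3M : 3000000 * (x.length + w.length) ≤ Dconst Kf * (x.length + w.length) := Nat.mul_le_mul_right _ (by rw [hDc]; omega)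
  have hsz₁ : ssize T₁ ≤ (boolPair x w).length + t₁ := by have := ex₁.ssize_le; rwa [hT0, ssize_single] at this
  -- phase 2
  obtain ⟨J, fin, Rfin, hin, hJ, hres, hregs, hJc, hinc, hiff, h01⟩ := seg_run_actual f Pf inpf outf hPf x sv
  have hspec := segJ_spec f Pf inpf outf hPf H
  have hJeq : J = segJ f Pf inpf outf hPf H :=
    FlatFuel.haltTime_unique (SEG Pf outf) ⟨0, (segCanon inpf H).store⟩ hinc (by rw [hJc]) hspec.1 (by rw [hspec.2.1])
  have hfin : fin.res = (segFin f Pf inpf outf hPf H).res := by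
    have e := hspec.2.1
    rw [← hJeq, hJc] at e
    have e' : fin.store = (segFin f Pf inpf outf hPf H).store := by injection e
    have := congrFun e' DReg.res
    simpa using this
  have hsat : FlatFuel.sat (Bad inpf) (SEG Pf outf).length c₀.pc = Bad inpf := by simp [FlatFuel.sat, hc₀]
  have hclk : ∀ k : DReg Kf, (some k : TR Kf) ≠ none := fun k => by simp
  by_cases hjJ : j < J
  · -- interrupted: the simulated answer
    have hin' : ∀ m ≤ j, ((SEG Pf outf).step^[m] c₀).pc < (SEG Pf outf).length := fun m hm => hin m (by omega)
    have hT := FlatFuel.tick_exhaust (Option.some_injective _) hclk (SEG Pf outf) D (Bad inpf) (Cad Pf inpf outf + 1)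
      (placed_tick Pf inpf outf) G₁ c₀ j hin'
    rw [hsat, ← hT₁] at hT
    set P₂ := FlatFuel.tstore G₁ some none ((SEG Pf outf).step^[j] c₀).regs [] with hP₂
    have hP₂n : P₂ none = [] := FlatFuel.tstore_clk _ _ _
    have hP₂s : ∀ r, P₂ (some r) = ((SEG Pf outf).step^[j] c₀).regs r := fun r =>
      FlatFuel.tstore_apply_g (Option.some_injective _) hclk _ _ _ r
    obtain ⟨gsv, gmark, gans⟩ := hregs j
    have h3 := runs_postTail P₂ (by rw [hP₂s, gmark]) (by rw [hP₂s, gans]) (by rw [hP₂s, gsv]; exact hsv01)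
    rw [hP₂s, gsv] at h3
    obtain ⟨t₃, ht₃, ex₃⟩ := h3
    have hD₃ := ex₃.iterate_step (placed_postTail Pf inpf outf)
    have hsz₂ : ssize P₂ ≤ ssize T₁ + (2 * j + 1) := by
      have := ssize_iterate_le D (2 * j + 1) ⟨Bad inpf, T₁⟩; rw [hT] at this; exact this
    refine ⟨decide (sv = [true]), t₃ + (2 * j + 1) + t₁, ?_, ?_, ?_⟩
    · rw [Function.iterate_add_apply, Function.iterate_add_apply, hD₁, hT, hD₃, length_Dprog]
    · unfold scConst at ht₁; simp only [length_boolPair] at hsz₁; omega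
    · rw [decide_eq_true_iff, hsviff, DSpec, ← hj, ← hH, ← hJeq]
      constructor
      · intro h; exact Or.inl ⟨hjJ, h⟩
      · rintro (⟨-, h⟩ | ⟨h, -⟩)
        · exact h
        · omega
  · -- completed
    have hJj : J ≤ j := Nat.le_of_not_lt hjJ
    have hT := FlatFuel.tick_complete (Option.some_injective _) hclk (SEG Pf outf) D (Bad inpf) (Cad Pf inpf outf + 1)
      (placed_tick Pf inpf outf) G₁ c₀ J j hin (by rw [hJ]) hJj
    rw [hsat, ← hT₁, hJ] at hT
    simp only at hT
    set P₂ := FlatFuel.tstore G₁ some none Rfin (un (j - J)) with hP₂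
    have hP₂n : P₂ none = un (j - J) := FlatFuel.tstore_clk _ _ _
    have hP₂s : ∀ r, P₂ (some r) = Rfin r := fun r => FlatFuel.tstore_apply_g (Option.some_injective _) hclk _ _ _ r
    obtain ⟨gsv, gmark, gans⟩ := hregs J
    rw [hJ] at gmark gans
    simp only at gmark gans
    have h3 := runs_postTop P₂ (by rw [hP₂s, gmark]) (by rw [hP₂s, gans]) (by rw [hP₂s, hres]; exact h01)
    rw [hP₂s, hres, hP₂n] at h3
    obtain ⟨t₃, ht₃, ex₃⟩ := h3
    have hD₃ := ex₃.iterate_step (placed_post Pf inpf outf)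
    have hsz₂ : ssize P₂ ≤ ssize T₁ + 2 * J := by
      have := ssize_iterate_le D (2 * J) ⟨Bad inpf, T₁⟩; rw [hT] at this; simpa [Cad] using this
    have hlen : D.length = Cad Pf inpf outf + (postTop : ACom Bool (TR Kf)).size := by
      rw [hD, length_Dprog]; simp [postTop, size]; omega
    have hT' : D.step^[2 * J] ⟨Bad inpf, T₁⟩ = ⟨Cad Pf inpf outf, P₂⟩ := by rw [hT]; rfl
    refine ⟨decide (un (j - J) = [] ∧ fin.res = []), t₃ + 2 * J + t₁, ?_, ?_, ?_⟩
    · rw [Function.iterate_add_apply, Function.iterate_add_apply, hD₁, hT', hD₃, hlen]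
    · unfold scConst at ht₁; simp only [length_boolPair] at hsz₁; omega
    · rw [decide_eq_true_iff, DSpec, ← hj, ← hH, ← hJeq, ← hfin]
      have hu : un (j - J) = [] ↔ j = J := by simp [un]; omega
      rw [hu]
      constructor
      · rintro ⟨h1, h2⟩; exact Or.inr ⟨h1, h2⟩
      · rintro (⟨h, -⟩ | h)
        · omega
        · exact h

end Run

/-! ### The diagonalizer and the hierarchy theorem -/

/-- Observation codes are at most `2`. [folklore] -/
theorem obsOf_le (l : List Bool) : UFlat.obsOf l ≤ 2 := by
  rcases l with _ | ⟨_ | _, _⟩ <;> simp [UFlat.obsOf]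

/-- The observations of a run sum to at most twice its length. [folklore] -/
theorem sum_uobs_le (P : UFlat.UProg) : ∀ (c : UFlat.UCfg) (t : ℕ), (UFlat.uobs P c t).sum ≤ 2 * t
  | c, 0 => by simp [UFlat.uobs]
  | c, t + 1 => by
    rw [UFlat.uobs, List.sum_cons]
    have ih := sum_uobs_le P (UFlat.ustep P c) t
    split
    · omega
    · rename_i i _
      split
      · omega
      · have := obsOf_le (c.2 i.k); omega

/-- A chain word extended by `1` is the next chain word. [folklore] -/
theorem chainInput_append_true (B : List Bool) (j : ℕ) : chainInput B j ++ [true] = chainInput B (j + 1) := by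
  simp [chainInput, List.replicate_succ']

/-- The header-and-pad word: the pair code of the header word with empty second component,
followed by the pad, is the pair code with the pad as second component. [folklore] -/
theorem boolPair_nil_append (b pad : List Bool) : boolPair b [] ++ pad = boolPair b pad := by
  simp [boolPair]

/-- **The diagonalizer exists for every time-constructible bound** — the named fact
`diagonalizer_of_timeConstructible` of `NTIMEHierarchyDiagonal.lean`, discharged.
[cite: Cook1973, Thm. 2; SeiferasFischerMeyer1978, Thm. 3; Zak1983; AroraBarak2009, Thm. 3.2] -/
theorem diagonalizer_of_timeConstructible_holds : diagonalizer_of_timeConstructible := by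
  intro f hf
  classical
  -- the clock program
  obtain ⟨N, a₁, hN⟩ := exists_unaryClock_of_timeConstructible hf
  obtain ⟨Kf, Pf, inpf, outf, ef, hNF⟩ := TM2Flat.exists_aprogFin_of_outputsWithin N
  have hPf : ∀ n : ℕ, ∃ t : ℕ, Pf.step^[t] ⟨0, AStore.single inpf (un n)⟩ =
      ⟨Pf.length, AStore.single outf (boolPair (un n) (un (f n)))⟩ := by
    intro n
    obtain ⟨t, -, ht⟩ := hNF (un n) _ _ (hN (un n))
    exact ⟨t, by simpa [un] using ht⟩
  have hpos : 0 < (Dprog Pf inpf outf).length := by rw [length_Dprog]; omega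
  refine ⟨{ D := fun x w => decide (DSpec f Pf inpf outf hPf x w),
             machine := AProg.aux (Dprog Pf inpf outf) hpos (some DReg.inreg) (some DReg.ans),
             a := Dconst Kf,
             outputsWithin := fun x w => ?_,
             diag := fun L c R M hM hL => ?_ }⟩
  · -- linear time on every pair word
    obtain ⟨b, t, hrun, ht, hb⟩ := D_run f Pf inpf outf hPf x w
    have hdb : decide (DSpec f Pf inpf outf hPf x w) = b := by
      cases b
      · simpa using hb
      · simpa using hb
    rw [hdb]
    exact (AProg.outputsWithin_of_iterate (Dprog Pf inpf outf) hpos (some DReg.inreg) (some DReg.ans) hrun le_rfl).mono ht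
  · -- the diagonal behaviour against the verifier `(c, R, M)`
    obtain ⟨R', M', a', hM'1, hM'2, hM'3⟩ := exists_normalVerifier hf hM hL
    obtain ⟨Kv, Pv, inpv, outv, ev, hNFv⟩ := TM2Flat.exists_aprogFin_of_outputsWithin M'
    -- the header fields
    set Pu := UFlat.toUProg Pv with hPu
    set m := Kv + 1 with hm
    set inp := inpv.val with hinp
    set out := outv.val with hout
    set Ky := out + inp + m with hKy
    set Y := (UChk.encProg Pu).length with hY
    -- the witness-length constant
    set T1 := ev * (a' + a' * c + 2 + c) with hT1
    set T0 := ev * (a' * c + a' + c + 3) + ev with hT0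
    set α := 2 * c + 4 * T1 + m * (4 * T1 + (Y + Ky) * T1) with hα
    set β := 2 * c + 3 + 4 * T0 + m * (4 * T0 + 1 + Y + Ky + (Y + Ky) * T0) with hβ
    set KD := α + β with hKD
    set E := 2 * KD with hE
    set b := hdrWord m inp out E Pu with hbdef
    -- the two key implications
    have SL : ∀ z v : List Bool, SimOK Pu Ky m inp out z v → z ∈ L := by
      rintro z v ⟨y, tt, rfl, os, pay, rfl, -, hacc⟩
      obtain ⟨t₀, -, h₀⟩ := hNFv (boolPair z y) _ _ (hM'1 z y)
      have hout := UFlat.out_eq_of_uAccepts (P := Pv) (inp := inpv) (out := outv) hacc h₀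
      rw [AStore.single_self] at hout
      have hR : R' z y = true := by
        cases h : R' z y
        · rw [h] at hout; exact absurd hout (by decide)
        · rfl
      exact (hM'2 z).2 ⟨y, hR⟩
    have LS : ∀ z : List Bool, z ∈ L → ∃ v : List Bool, v.length ≤ KD * f z.length + KD ∧ SimOK Pu Ky m inp out z v := by
      intro z hz
      obtain ⟨y, hy⟩ := (hM'2 z).1 hz
      obtain ⟨hyl, hy'⟩ := hM'3 z y hy
      set y' := y.take (c * f z.length + c) with hy'def
      obtain ⟨t₀, ht₀, h₀⟩ := hNFv (boolPair z y') _ _ (hM'1 z y')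
      rw [hy'] at h₀
      have hacc := UFlat.uAccepts_of_iterate (P := Pv) (inp := inpv) (out := outv) h₀ (by simp [Computability.encodeBool])
      set os := UFlat.uobs (UFlat.toUProg Pv) (0, UFlat.initStore inpv.val (boolPair z y')) t₀ with hos
      set pay := un (m * UChk.payTotal (UChk.encProg Pu).length (UChk.encClaims os).length Ky os) with hpay
      refine ⟨boolPair y' (UChk.encClaims os ++ pay), ?_, y', UChk.encClaims os ++ pay, rfl, os, pay, rfl, by simp [hpay, hPu, un], hacc⟩
      -- the length of the witness
      have hosl : os.length = t₀ := by simp [hos]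
      have hoss : os.sum ≤ 2 * t₀ := by rw [hos]; exact sum_uobs_le _ _ _
      have hC : (UChk.encClaims os).length ≤ 4 * t₀ + 1 := by rw [UChk.length_encClaims]; omega
      have hn := hf.1 z.length
      set F := f z.length with hF
      have hl1 : (Computability.encodeBool (R' z y')).length = 1 := rfl
      rw [hl1, length_boolPair] at ht₀
      -- `t₀ ≤ T1 F + T0`
      have i1 : a' * (F + y'.length) ≤ a' * F + a' * (c * F) + a' * c := by
        have := Nat.mul_le_mul_left a' (Nat.add_le_add_left hyl F)
        have e : a' * (F + (c * F + c)) = a' * F + a' * (c * F) + a' * c := by ring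
        omega
      have i2 : a' * (F + y'.length) + a' + (2 * z.length + 2 + y'.length) + 1 ≤
          (a' + a' * c + 2 + c) * F + (a' * c + a' + c + 3) := by
        have e : (a' + a' * c + 2 + c) * F = a' * F + a' * (c * F) + 2 * F + c * F := by ring
        omega
      have i3 := Nat.mul_le_mul_left ev i2
      have ht₀' : t₀ ≤ T1 * F + T0 := by
        have e : T1 * F + T0 = ev * ((a' + a' * c + 2 + c) * F + (a' * c + a' + c + 3)) + ev := by rw [hT1, hT0]; ring
        omega
      -- the witness length
      have hpl : pay.length = m * ((UChk.encClaims os).length + Y + Ky + (Y + Ky) * os.length) := by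
        simp [hpay, UChk.payTotal, un, hY]
      have h1 : m * ((UChk.encClaims os).length + Y + Ky + (Y + Ky) * os.length) ≤
          m * (4 * (T1 * F + T0) + 1 + Y + Ky + (Y + Ky) * (T1 * F + T0)) := by
        refine Nat.mul_le_mul_left _ ?_
        have : (Y + Ky) * os.length ≤ (Y + Ky) * (T1 * F + T0) := Nat.mul_le_mul_left _ (by rw [hosl]; exact ht₀')
        omega
      have hid : 2 * (c * F + c) + 2 + (4 * (T1 * F + T0) + 1) + m * (4 * (T1 * F + T0) + 1 + Y + Ky + (Y + Ky) * (T1 * F + T0)) =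
          α * F + β := by rw [hα, hβ]; ring
      have hαK : α * F ≤ KD * F := Nat.mul_le_mul_right _ (by omega)
      have hβK : β ≤ KD := by omega
      simp only [length_boolPair, List.length_append]
      omega
    -- the header, the base, the chain
    have hhdr : hdrOf b = ⟨m, inp, out, E, Pu⟩ := by simpa [hbdef] using hdrOf_hdrWord m inp out E Pu []
    refine ⟨boolPair b [], KD, fun pad => ?_⟩
    set H := boolPair b [] ++ pad with hH
    have hHb : H = boolPair b pad := boolPair_nil_append b pad
    have hbOf : bOf H = b := by rw [hHb, bOf, DiagPrelims.unpair_boolPair]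
    have hfx : ∀ j, jOf (chainInput H j) = j ∧ HOf (chainInput H j) = H := fun j => jOf_chainInput H j
    have hhx : ∀ j, hdrX (chainInput H j) = ⟨m, inp, out, E, Pu⟩ := fun j => by rw [hdrX, (hfx j).2, hbOf, hhdr]
    have hKx : ∀ j, KX (chainInput H j) = Ky := fun j => by rw [KX, hhx]
    set J := segJ f Pf inpf outf hPf H with hJ
    have hspec := segJ_spec f Pf inpf outf hPf H
    rw [hbOf, hhdr] at hspec
    simp only at hspec
    -- `D` on the chain
    have hD : ∀ (j : ℕ) (w : List Bool), DSpec f Pf inpf outf hPf (chainInput H j) w ↔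
        (j < J ∧ SimOK Pu Ky m inp out (chainInput H (j + 1)) w) ∨ (j = J ∧ (segFin f Pf inpf outf hPf H).res = []) := by
      intro j w
      rw [DSpec, (hfx j).1, (hfx j).2, hhx, hKx, chainInput_append_true]
    refine ⟨J, fun j hj w hDw => ?_, fun j hj hL' => ?_, fun w => ?_⟩
    · -- (i) soundness at the simulated positions
      rw [decide_eq_true_iff, hD] at hDw
      rcases hDw with ⟨-, h⟩ | ⟨h, -⟩
      · exact SL _ _ h
      · omega
    · -- (ii) completeness at the simulated positions
      obtain ⟨v, hvl, hv⟩ := LS _ hL'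
      exact ⟨v, hvl, by rw [decide_eq_true_iff, hD]; exact Or.inl ⟨hj, hv⟩⟩
    · -- (iii) the flip at the end of the chain
      rw [decide_eq_true_iff, hD]
      have h0 : chainInput H 0 = H ++ [false] := by simp [chainInput]
      have hn0 : 1 ≤ f (H.length + 1) := le_trans (Nat.succ_le_succ (Nat.zero_le _)) (hf.1 _)
      constructor
      · rintro (⟨h, -⟩ | ⟨-, hres⟩)
        · omega
        · intro hL0
          obtain ⟨v, hvl, hv⟩ := LS _ hL0
          have hres' : (segFin f Pf inpf outf hPf H).res = [true] := by
            refine hspec.2.2.1.2 ⟨v, ?_, by rwa [h0] at hv⟩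
            rw [h0, List.length_append, List.length_singleton] at hvl
            have : KD * f (H.length + 1) + KD ≤ E * f (H.length + 1) := by rw [hE]; nlinarith
            omega
          rw [hres] at hres'; simp at hres'
      · intro hL0
        refine Or.inr ⟨rfl, ?_⟩
        rcases hspec.2.2.2 with h | h
        · exact h
        · exfalso
          obtain ⟨v, -, hv⟩ := hspec.2.2.1.1 h
          exact hL0 (by rw [h0]; exact SL _ _ hv)

/-- **The nondeterministic time hierarchy theorem** (Cook 1973; Seiferas–Fischer–Meyer 1978;
Žák 1983), in the tree's form `ntime_hierarchy`: for time-constructible `f`, `g` with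
`f(n+1) = o(g(n))`, `NTIME g ⊄ NTIME f`. [cite: Cook1973, Thm. 2; SeiferasFischerMeyer1978, Thm. 3;
Zak1983; AroraBarak2009, Thm. 3.2] -/
theorem ntime_hierarchy_holds : ntime_hierarchy := ntime_hierarchy_of_diagonalizer diagonalizer_of_timeConstructible_holds

end Diag

end Literature.Computability.Complexity
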